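import Mathlib
import Summits.NavierStokesRegularity.OSWSelfSimilar.SheetNSLineTorusCascadeWiener
import HarnessLib

/-!
# Viscous CLM on the torus (`a = 0`, `σ = 2`): THE WINDOW-WIENER SET IS OPEN — analyticity-radius gain for the nonnegative
# cascade by a Riccati comparison on the weighted Galerkin difference

HONEST FRAMING (cell ns-blowup GROUP B «PROFILE SEARCH», zone Z3, row Z3-U addendum A-F2 of `HOME/profile/z3/CENSUS-Z3.md`;
human rulings D-0035/D-0074; Z3-TWIN lineage, eng-5 g15): **1-D MODEL (viscous Constantin–Lax–Majda equation
`ω_t = ω Hω + ν ω_xx` on `𝕋`); ODE calculus (one Riccati comparison on Galerkin sums) on the Fourier cascade, kernel-checked; not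
Euler, not Navier–Stokes; «violates: none — MODEL».**

OBJECT (from the tree): the nonnegative cascade `IsNonnegCascade ν e` of `SheetNSLineTorusCascadeWiener` (`ė_k = ½ Σ_{i+j=k} e_i e_j − νk² e_k`
for `t > 0`, `e_0 ≡ 0`, `e_k(0) ≥ 0`, continuous on `[0, ∞)`). No definitions here.

THE ESTIMATE (`IsNonnegCascade.partialSum_smul_le`). Let `ν ≥ 0`, first mode present, and suppose the Galerkin sums are bounded on a
window, `S_K(t) = Σ_{k≤K} e_k(t) ≤ B` for `t ∈ [0, L]` and all `K`. Let `ρ > 1`. The weighted difference `D_K = Σ_{k≤K} (ρ^k − 1) e_k ≥ 0`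
obeys, by Cauchy-product domination with the weight (`sum_conv_weight_sub_one_le`: `Σ_{k≤K} Σ_{i+j=k} (ρ^k − 1) e_i e_j ≤ W_K² − S_K²`,
`W_K = Σ_{k≤K} ρ^k e_k = S_K + D_K`; dissipation dropped),

  `D_K′ ≤ ½ (W_K² − S_K²) = ½ D_K² + S_K D_K ≤ ½ D_K² + B D_K`     on `(0, L)`,

a Riccati inequality from the SMALL datum `D_K(0) ≤ δ`. The `1/y`-monotonicity device of `partialSum_le_riccati` (`y = e^{−Bt} D_K`,
`1/y + e^{Bt}/(2B)` non-decreasing on `[0, L]`) gives `D_K ≤ 2δ e^{BL}` on `[0, L]` as soon as `δ (e^{BL} − 1) ≤ B`; hence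
**`W_K ≤ B + 2δ e^{BL}` on the SAME window, for every `K`** — a Wiener bound at a strictly larger amplitude / analyticity radius.
Also here: the size-free SHORT-TIME Riccati bound `partialSum_le_two_mul` (`S′ ≤ ½S²`: `S_K(t) ≤ 2W` for `0 ≤ t ≤ 1/W` when
`S_K(0) ≤ W`), and the two combinatorial lemmas `sum_antidiagonal_le_sum_sum`, `sum_conv_weight_sub_one_le`.

USE. The sequel `SheetNSLineTorusCascadeThresholdWiener` applies this to the universal family `κ^k E_k`: the window-Wiener sets are open,
`κ*` is exactly the (unattained) Wiener threshold; `SheetNSLineTorusCascadeThresholdCritical` adds the PDE statement «the critical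
amplitude `c = κ*ν` is NOT global».

bears_on: LADDER-NS N5 / zone Z3 (row Z3-U, A-F2 (t1) datum-free tier, dichotomy form) → N1 linear core. WHAT THIS IS NOT: not NS; no
PDE object and no threshold statement in this file.
-/

noncomputable section

namespace Summit.NavierStokesRegularity.OSWSelfSimilar
namespace SheetNSLineTorusCascade

open Finset Real Set Filter
open scoped Topology

/-! ### Cauchy-product domination with a weight -/

/-- **Antidiagonal sums over `k ≤ K` are dominated by the full square sum** for a nonnegative kernel `g`:
`Σ_{k≤K} Σ_{i+j=k} g i j ≤ Σ_{i≤K} Σ_{j≤K} g i j` (the pairs with `i + j ≤ K` inject into `[0,K]²`). [folklore] -/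
theorem sum_antidiagonal_le_sum_sum {g : ℕ → ℕ → ℝ} (hg : ∀ i j, 0 ≤ g i j) (K : ℕ) :
    ∑ k ∈ range (K + 1), ∑ p ∈ antidiagonal k, g p.1 p.2
      ≤ ∑ i ∈ range (K + 1), ∑ j ∈ range (K + 1), g i j := by
  have hdisj : (↑(range (K + 1)) : Set ℕ).PairwiseDisjoint antidiagonal := by
    intro a _ b _ hab
    refine disjoint_left.mpr fun p hpa hpb => hab ?_
    have ha := HasAntidiagonal.mem_antidiagonal.mp hpa
    have hb := HasAntidiagonal.mem_antidiagonal.mp hpb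
    omega
  rw [← sum_biUnion hdisj, ← sum_product']
  refine sum_le_sum_of_subset_of_nonneg ?_ (fun p _ _ => hg _ _)
  intro p hp
  obtain ⟨k, hk, hpk⟩ := mem_biUnion.mp hp
  have hpk' := HasAntidiagonal.mem_antidiagonal.mp hpk
  have hk' := Finset.mem_range.mp hk
  rw [Finset.mem_product, Finset.mem_range, Finset.mem_range]
  omega

/-- **Weighted Cauchy-product domination**: for `f ≥ 0` and `ρ ≥ 1`,
`Σ_{k≤K} Σ_{i+j=k} (ρ^k − 1) f_i f_j ≤ (Σ_{k≤K} ρ^k f_k)² − (Σ_{k≤K} f_k)²`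
(`ρ^{i+j} − 1 ≥ 0`, and the square sum splits as `Σ ρ^i f_i ρ^j f_j − Σ f_i f_j`). [folklore] -/
theorem sum_conv_weight_sub_one_le {f : ℕ → ℝ} (hf : ∀ k, 0 ≤ f k) {ρ : ℝ} (hρ : 1 ≤ ρ) (K : ℕ) :
    ∑ k ∈ range (K + 1), ∑ p ∈ antidiagonal k, (ρ ^ k - 1) * (f p.1 * f p.2)
      ≤ (∑ k ∈ range (K + 1), ρ ^ k * f k) ^ 2 - (∑ k ∈ range (K + 1), f k) ^ 2 := by
  have h1 : ∑ k ∈ range (K + 1), ∑ p ∈ antidiagonal k, (ρ ^ k - 1) * (f p.1 * f p.2)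
      = ∑ k ∈ range (K + 1), ∑ p ∈ antidiagonal k, (ρ ^ (p.1 + p.2) - 1) * (f p.1 * f p.2) := by
    refine sum_congr rfl fun k _ => sum_congr rfl fun p hp => ?_
    rw [mem_antidiagonal.mp hp]
  rw [h1]
  have h2 := sum_antidiagonal_le_sum_sum (g := fun i j => (ρ ^ (i + j) - 1) * (f i * f j))
    (fun i j => mul_nonneg (sub_nonneg.mpr (one_le_pow₀ hρ)) (mul_nonneg (hf i) (hf j))) K
  refine h2.trans (le_of_eq ?_)
  rw [sq, sq, sum_mul_sum, sum_mul_sum, ← sum_sub_distrib]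
  refine sum_congr rfl fun i _ => ?_
  rw [← sum_sub_distrib]
  refine sum_congr rfl fun j _ => ?_
  rw [pow_add]
  ring

namespace IsNonnegCascade

variable {ν : ℝ} {e : ℕ → ℝ → ℝ}

/-! ### Short-time Riccati bound without size condition -/

/-- **SHORT-TIME WIENER BOUND (no size condition).** For a nonnegative cascade with `ν ≥ 0`, first mode present and
`Σ_{k≤K} e_k(0) ≤ W` for every `K`: `Σ_{k≤K} e_k(t) ≤ 2W` for all `K` and `0 ≤ t ≤ 1/W` (`S′ ≤ ½S²`, so `1/S + t/2` is
non-decreasing and `1/S(t) ≥ 1/W − t/2 ≥ 1/(2W)`). [new here — MODEL] -/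
theorem partialSum_le_two_mul (he : IsNonnegCascade ν e) (hν : 0 ≤ ν) (h1 : 0 < e 1 0) {W : ℝ}
    (hdata : ∀ K, ∑ k ∈ range (K + 1), e k 0 ≤ W) (K : ℕ) {t : ℝ} (ht : 0 ≤ t) (htW : t ≤ 1 / W) :
    ∑ k ∈ range (K + 1), e k t ≤ 2 * W := by
  -- reduce to `K ≥ 1`
  have hmonoK : ∑ k ∈ range (K + 1), e k t ≤ ∑ k ∈ range (max K 1 + 1), e k t :=
    sum_le_sum_of_subset_of_nonneg (range_subset_range.mpr (Nat.succ_le_succ (le_max_left K 1)))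
      (fun k _ _ => he.nonneg k t ht)
  refine le_trans hmonoK ?_
  set K' := max K 1 with hK'
  have hK1 : 1 ≤ K' := le_max_right _ _
  set S : ℝ → ℝ := fun s => ∑ k ∈ range (K' + 1), e k s with hSdef
  have hS0W : S 0 ≤ W := hdata K'
  -- `S > 0` on `[0, ∞)`
  have hSpos : ∀ s, 0 ≤ s → 0 < S s := by
    intro s hs
    have hle : e 1 s ≤ S s :=
      single_le_sum (f := fun k => e k s) (fun k _ => he.nonneg k s hs) (mem_range.mpr (by omega))
    have h1s : 0 < e 1 s := by
      have := he.init_mul_exp_le 1 s hs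
      have hpos : 0 < e 1 0 * exp (-(ν * ((1 : ℕ) : ℝ) ^ 2 * s)) := mul_pos h1 (exp_pos _)
      linarith
    linarith
  have hS0pos : 0 < S 0 := hSpos 0 le_rfl
  have hWpos : 0 < W := lt_of_lt_of_le hS0pos hS0W
  have hS' : ∀ s, 0 < s → HasDerivAt S
      (∑ k ∈ range (K' + 1), ((1 / 2) * (∑ p ∈ antidiagonal k, e p.1 s * e p.2 s) - ν * (k : ℝ) ^ 2 * e k s)) s :=
    fun s hs => HasDerivAt.fun_sum fun k _ => he.ode k s hs
  have hScont : ContinuousOn S (Ici 0) := continuousOn_finsetSum _ fun k _ => he.cont k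
  -- `ψ = 1/S + s/2` is non-decreasing on `[0, ∞)`
  have hψmono : MonotoneOn (fun s => (S s)⁻¹ + s / 2) (Ici 0) := by
    refine monotoneOn_of_hasDerivWithinAt_nonneg
      (f' := fun s => -(∑ k ∈ range (K' + 1),
          ((1 / 2) * (∑ p ∈ antidiagonal k, e p.1 s * e p.2 s) - ν * (k : ℝ) ^ 2 * e k s)) / (S s) ^ 2 + 1 / 2)
      (convex_Ici 0) ?_ (fun s hs => ?_) (fun s hs => ?_)
    · exact (ContinuousOn.inv₀ hScont (fun s hs => (hSpos s hs).ne')).add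
        ((continuous_id.div_const 2).continuousOn)
    · rw [interior_Ici] at hs ⊢
      have h1 := (hS' s hs).inv (hSpos s hs.le).ne'
      have h2 : HasDerivAt (fun s : ℝ => s / 2) (1 / 2) s := by
        simpa using (hasDerivAt_id s).div_const 2
      exact (h1.add h2).hasDerivWithinAt
    · rw [interior_Ici] at hs
      have hs0 : 0 ≤ s := hs.le
      have hrhs := sum_rhs_le he hν K' s hs0
      have hSs := hSpos s hs0
      have hle : ∑ k ∈ range (K' + 1),
          ((1 / 2) * (∑ p ∈ antidiagonal k, e p.1 s * e p.2 s) - ν * (k : ℝ) ^ 2 * e k s) ≤ (1 / 2) * (S s) ^ 2 := by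
        have : 0 ≤ ν * S s := mul_nonneg hν hSs.le
        change _ ≤ (1 / 2) * (∑ k ∈ range (K' + 1), e k s) ^ 2 - ν * ∑ k ∈ range (K' + 1), e k s at hrhs
        linarith
      have hdiv : (∑ k ∈ range (K' + 1),
          ((1 / 2) * (∑ p ∈ antidiagonal k, e p.1 s * e p.2 s) - ν * (k : ℝ) ^ 2 * e k s)) / (S s) ^ 2 ≤ 1 / 2 := by
        rw [div_le_iff₀ (by positivity)]
        linarith
      rw [neg_div]
      linarith
  have hψ := hψmono (self_mem_Ici) ht ht
  simp only [zero_div, add_zero] at hψ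
  -- `1/S(t) ≥ 1/S(0) − t/2 ≥ 1/W − 1/(2W) = 1/(2W)`
  have hinv0 : W⁻¹ ≤ (S 0)⁻¹ := inv_anti₀ hS0pos hS0W
  have htW' : t / 2 ≤ W⁻¹ / 2 := by rw [one_div] at htW; linarith
  have hM : (2 * W)⁻¹ ≤ (S t)⁻¹ := by
    have h2 : (2 * W)⁻¹ = W⁻¹ / 2 := by ring
    rw [h2]
    linarith
  have h2W : 0 < 2 * W := by positivity
  have := inv_anti₀ (inv_pos.mpr h2W) hM
  rwa [inv_inv, inv_inv] at this

/-! ### The openness estimate: a Wiener bound propagates to a larger amplitude on the same window -/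

/-- **ANALYTICITY-RADIUS GAIN (openness of the window-Wiener set).** Nonnegative cascade, `ν ≥ 0`, first mode present,
Galerkin sums `Σ_{k≤K} e_k(t) ≤ B` on `[0, L]`; `ρ > 1` with weighted datum `Σ_{k≤K} (ρ^k − 1) e_k(0) ≤ δ` for every `K`, where
`δ > 0` and `δ (e^{BL} − 1) ≤ B`. Then **`Σ_{k≤K} ρ^k e_k(t) ≤ B + 2δ e^{BL}` for every `K` and every `t ∈ [0, L]`.**
(`D = Σ (ρ^k − 1) e_k` obeys `D′ ≤ ½D² + B·D`; compare through `1/(e^{−Bt}D) + e^{Bt}/(2B)` non-decreasing.) [new here — MODEL] -/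
theorem partialSum_smul_le (he : IsNonnegCascade ν e) (hν : 0 ≤ ν) (h1 : 0 < e 1 0) {B L ρ δ : ℝ}
    (hρ : 1 < ρ) (hδ : 0 < δ)
    (hB : ∀ K : ℕ, ∀ t ∈ Icc (0 : ℝ) L, ∑ k ∈ range (K + 1), e k t ≤ B)
    (hinit : ∀ K : ℕ, ∑ k ∈ range (K + 1), (ρ ^ k - 1) * e k 0 ≤ δ)
    (hsmall : δ * (Real.exp (B * L) - 1) ≤ B)
    (K : ℕ) {t : ℝ} (ht : t ∈ Icc (0 : ℝ) L) :
    ∑ k ∈ range (K + 1), ρ ^ k * e k t ≤ B + 2 * δ * Real.exp (B * L) := by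
  have hL : 0 ≤ L := ht.1.trans ht.2
  have ht0 : 0 ≤ t := ht.1
  -- `B > 0`: the window bound at `K = 1`, `t = 0` reads `e 1 0 ≤ B`
  have hB0 : 0 < B := by
    have h := hB 1 0 ⟨le_rfl, hL⟩
    rw [sum_range_succ, sum_range_succ, sum_range_zero, he.zero 0] at h
    linarith
  -- the case `K = 0`: the sum is `e 0 t = 0`
  rcases Nat.eq_zero_or_pos K with hK0 | hK1
  · subst hK0
    rw [sum_range_succ, sum_range_zero, he.zero t]
    have : 0 ≤ 2 * δ * Real.exp (B * L) := by positivity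
    linarith
  have hK1' : 1 ≤ K := hK1
  -- the three Galerkin functionals
  set S : ℝ → ℝ := fun s => ∑ k ∈ range (K + 1), e k s with hSdef
  set D : ℝ → ℝ := fun s => ∑ k ∈ range (K + 1), (ρ ^ k - 1) * e k s with hDdef
  have hWSD : ∀ s, ∑ k ∈ range (K + 1), ρ ^ k * e k s = S s + D s := by
    intro s
    simp only [hSdef, hDdef, ← sum_add_distrib]
    exact sum_congr rfl fun k _ => by ring
  have hρ1 : 1 ≤ ρ := hρ.le
  have hwk : ∀ k : ℕ, 0 ≤ ρ ^ k - 1 := fun k => sub_nonneg.mpr (one_le_pow₀ hρ1)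
  -- `D > 0` on `[0, ∞)` (the first mode carries the weight `ρ − 1 > 0`)
  have hDpos : ∀ s, 0 ≤ s → 0 < D s := by
    intro s hs
    have hle : (ρ ^ 1 - 1) * e 1 s ≤ D s :=
      single_le_sum (f := fun k => (ρ ^ k - 1) * e k s) (fun k _ => mul_nonneg (hwk k) (he.nonneg k s hs))
        (mem_range.mpr (by omega))
    have h1s : 0 < e 1 s := by
      have := he.init_mul_exp_le 1 s hs
      have hpos : 0 < e 1 0 * exp (-(ν * ((1 : ℕ) : ℝ) ^ 2 * s)) := mul_pos h1 (exp_pos _)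
      linarith
    have : 0 < (ρ ^ 1 - 1) * e 1 s := mul_pos (by rw [pow_one]; linarith) h1s
    linarith
  have hDnn : ∀ s, 0 ≤ s → 0 ≤ D s := fun s hs => (hDpos s hs).le
  -- derivative of `D` on `s > 0`
  have hD' : ∀ s, 0 < s → HasDerivAt D
      (∑ k ∈ range (K + 1), (ρ ^ k - 1) *
        ((1 / 2) * (∑ p ∈ antidiagonal k, e p.1 s * e p.2 s) - ν * (k : ℝ) ^ 2 * e k s)) s :=
    fun s hs => HasDerivAt.fun_sum fun k _ => (he.ode k s hs).const_mul (ρ ^ k - 1)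
  have hDcont : ContinuousOn D (Icc 0 L) :=
    (continuousOn_finsetSum _ fun k _ => continuousOn_const.mul (he.cont k)).mono Icc_subset_Ici_self
  -- THE RICCATI INEQUALITY `D′ ≤ ½ D² + B D` on `(0, L)`
  have hkey : ∀ s ∈ Ioo (0 : ℝ) L,
      ∑ k ∈ range (K + 1), (ρ ^ k - 1) *
        ((1 / 2) * (∑ p ∈ antidiagonal k, e p.1 s * e p.2 s) - ν * (k : ℝ) ^ 2 * e k s)
        ≤ (1 / 2) * (D s) ^ 2 + B * D s := by
    intro s hs
    have hs0 : 0 ≤ s := hs.1.le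
    have hSs : S s ≤ B := hB K s ⟨hs0, hs.2.le⟩
    have hSnn : 0 ≤ S s := sum_nonneg fun k _ => he.nonneg k s hs0
    -- drop the dissipation, pull the weight into the convolution
    have hdrop : ∑ k ∈ range (K + 1), (ρ ^ k - 1) *
        ((1 / 2) * (∑ p ∈ antidiagonal k, e p.1 s * e p.2 s) - ν * (k : ℝ) ^ 2 * e k s)
        ≤ (1 / 2) * ∑ k ∈ range (K + 1), ∑ p ∈ antidiagonal k, (ρ ^ k - 1) * (e p.1 s * e p.2 s) := by
      rw [mul_sum]
      refine sum_le_sum fun k _ => ?_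
      have hdiss : 0 ≤ (ρ ^ k - 1) * (ν * (k : ℝ) ^ 2 * e k s) :=
        mul_nonneg (hwk k) (mul_nonneg (by positivity) (he.nonneg k s hs0))
      have hid : (1 / 2) * ∑ p ∈ antidiagonal k, (ρ ^ k - 1) * (e p.1 s * e p.2 s)
          = (ρ ^ k - 1) * ((1 / 2) * ∑ p ∈ antidiagonal k, e p.1 s * e p.2 s) := by
        simp only [Finset.mul_sum]
        exact sum_congr rfl fun p _ => by ring
      rw [hid, mul_sub]
      linarith
    have hconv := sum_conv_weight_sub_one_le (f := fun k => e k s) (fun k => he.nonneg k s hs0) hρ1 K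
    have hW : ∑ k ∈ range (K + 1), ρ ^ k * e k s = S s + D s := hWSD s
    rw [hW] at hconv
    -- `½((S+D)² − S²) = ½D² + S·D ≤ ½D² + B·D`
    have hSD : S s * D s ≤ B * D s := mul_le_mul_of_nonneg_right hSs (hDnn s hs0)
    have : (1 / 2) * ∑ k ∈ range (K + 1), ∑ p ∈ antidiagonal k, (ρ ^ k - 1) * (e p.1 s * e p.2 s)
        ≤ (1 / 2) * ((S s + D s) ^ 2 - (S s) ^ 2) := by
      have := mul_le_mul_of_nonneg_left hconv (by norm_num : (0 : ℝ) ≤ 1 / 2)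
      simpa [hSdef] using this
    nlinarith
  -- `y = e^{−Bs} D`, `φ = 1/y + e^{Bs}/(2B)` is non-decreasing on `[0, L]`
  set y : ℝ → ℝ := fun s => Real.exp (-(B * s)) * D s with hy
  have hypos : ∀ s, 0 ≤ s → 0 < y s := fun s hs => mul_pos (exp_pos _) (hDpos s hs)
  have hy' : ∀ s, 0 < s → HasDerivAt y (Real.exp (-(B * s)) * (-B) * D s + Real.exp (-(B * s)) *
      (∑ k ∈ range (K + 1), (ρ ^ k - 1) *
        ((1 / 2) * (∑ p ∈ antidiagonal k, e p.1 s * e p.2 s) - ν * (k : ℝ) ^ 2 * e k s))) s := by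
    intro s hs
    have he1 : HasDerivAt (fun s => Real.exp (-(B * s))) (Real.exp (-(B * s)) * (-B)) s := by
      have := ((hasDerivAt_id s).const_mul B).neg.exp
      simpa using this
    exact he1.mul (hD' s hs)
  have hφmono : MonotoneOn (fun s => (y s)⁻¹ + Real.exp (B * s) / (2 * B)) (Icc 0 L) := by
    refine monotoneOn_of_hasDerivWithinAt_nonneg
      (f' := fun s => -(Real.exp (-(B * s)) * (-B) * D s + Real.exp (-(B * s)) *
          (∑ k ∈ range (K + 1), (ρ ^ k - 1) *
            ((1 / 2) * (∑ p ∈ antidiagonal k, e p.1 s * e p.2 s) - ν * (k : ℝ) ^ 2 * e k s))) / (y s) ^ 2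
          + Real.exp (B * s) * B / (2 * B))
      (convex_Icc 0 L) ?_ (fun s hs => ?_) (fun s hs => ?_)
    · refine ContinuousOn.add ?_ ?_
      · refine ContinuousOn.inv₀ ?_ (fun s hs => (hypos s hs.1).ne')
        exact ((continuous_exp.comp ((continuous_const.mul continuous_id).neg)).continuousOn).mul hDcont
      · exact ((continuous_exp.comp (continuous_const.mul continuous_id)).div_const _).continuousOn
    · rw [interior_Icc] at hs ⊢
      have hd1 := (hy' s hs.1).inv (hypos s hs.1.le).ne'
      have hd2 : HasDerivAt (fun s => Real.exp (B * s) / (2 * B)) (Real.exp (B * s) * B / (2 * B)) s := by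
        have := (((hasDerivAt_id s).const_mul B).exp).div_const (2 * B)
        simpa using this
      exact (hd1.add hd2).hasDerivWithinAt
    · rw [interior_Icc] at hs
      have hs0 : 0 ≤ s := hs.1.le
      have hyp := hypos s hs0
      have hk := hkey s hs
      have hE : 0 < Real.exp (-(B * s)) := exp_pos _
      -- `y′ ≤ ½ e^{Bs} y²`
      have hy'le : Real.exp (-(B * s)) * (-B) * D s + Real.exp (-(B * s)) *
          (∑ k ∈ range (K + 1), (ρ ^ k - 1) *
            ((1 / 2) * (∑ p ∈ antidiagonal k, e p.1 s * e p.2 s) - ν * (k : ℝ) ^ 2 * e k s))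
          ≤ (1 / 2) * Real.exp (B * s) * (y s) ^ 2 := by
        have h2 := mul_le_mul_of_nonneg_left hk hE.le
        have hid : (1 / 2) * Real.exp (B * s) * (y s) ^ 2 = Real.exp (-(B * s)) * ((1 / 2) * (D s) ^ 2) := by
          show (1 / 2) * Real.exp (B * s) * (Real.exp (-(B * s)) * D s) ^ 2 = Real.exp (-(B * s)) * ((1 / 2) * (D s) ^ 2)
          have hee : Real.exp (B * s) * Real.exp (-(B * s)) = 1 := by rw [← Real.exp_add]; simp
          calc (1 / 2) * Real.exp (B * s) * (Real.exp (-(B * s)) * D s) ^ 2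
              = (1 / 2) * (Real.exp (B * s) * Real.exp (-(B * s))) * Real.exp (-(B * s)) * (D s) ^ 2 := by ring
            _ = Real.exp (-(B * s)) * ((1 / 2) * (D s) ^ 2) := by rw [hee]; ring
        rw [hid]
        have : Real.exp (-(B * s)) * (-B) * D s + Real.exp (-(B * s)) *
            (∑ k ∈ range (K + 1), (ρ ^ k - 1) *
              ((1 / 2) * (∑ p ∈ antidiagonal k, e p.1 s * e p.2 s) - ν * (k : ℝ) ^ 2 * e k s))
            ≤ Real.exp (-(B * s)) * (-B) * D s + Real.exp (-(B * s)) * ((1 / 2) * (D s) ^ 2 + B * D s) := by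
          linarith
        have hzero : Real.exp (-(B * s)) * (-B) * D s + Real.exp (-(B * s)) * ((1 / 2) * (D s) ^ 2 + B * D s)
            = Real.exp (-(B * s)) * ((1 / 2) * (D s) ^ 2) := by ring
        linarith
      have hterm : Real.exp (B * s) * B / (2 * B) = (1 / 2) * Real.exp (B * s) := by
        field_simp
      rw [hterm, neg_div]
      have hdiv : (Real.exp (-(B * s)) * (-B) * D s + Real.exp (-(B * s)) *
          (∑ k ∈ range (K + 1), (ρ ^ k - 1) *
            ((1 / 2) * (∑ p ∈ antidiagonal k, e p.1 s * e p.2 s) - ν * (k : ℝ) ^ 2 * e k s))) / (y s) ^ 2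
            ≤ (1 / 2) * Real.exp (B * s) := by
        rw [div_le_iff₀ (by positivity)]
        exact hy'le
      linarith
  -- integrate: `φ(t) ≥ φ(0)`
  have hφ := hφmono ⟨le_rfl, hL⟩ ht ht0
  simp only [mul_zero, Real.exp_zero] at hφ
  have hy0 : y 0 = D 0 := by simp [hy]
  rw [hy0] at hφ
  -- `D 0 ≤ δ`, so `1/D(0) ≥ 1/δ`
  have hD0δ : D 0 ≤ δ := hinit K
  have hD0pos : 0 < D 0 := hDpos 0 le_rfl
  have hinvδ : δ⁻¹ ≤ (D 0)⁻¹ := inv_anti₀ hD0pos hD0δ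
  -- `e^{Bt} ≤ e^{BL}` and `(e^{BL} − 1)/(2B) ≤ 1/(2δ)`
  have hexpL : Real.exp (B * t) ≤ Real.exp (B * L) :=
    Real.exp_le_exp.mpr (mul_le_mul_of_nonneg_left ht.2 hB0.le)
  have hexpL' : Real.exp (B * t) / (2 * B) ≤ Real.exp (B * L) / (2 * B) :=
    div_le_div_of_nonneg_right hexpL (by positivity)
  have h5 : Real.exp (B * L) - 1 ≤ δ⁻¹ * B := by
    have := mul_le_mul_of_nonneg_left hsmall (inv_pos.mpr hδ).le
    rwa [← mul_assoc, inv_mul_cancel₀ hδ.ne', one_mul] at this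
  have h6 : (Real.exp (B * L) - 1) / (2 * B) ≤ δ⁻¹ / 2 := by
    rw [div_le_div_iff₀ (by positivity) (by norm_num)]
    linarith
  have hsplit : Real.exp (B * L) / (2 * B) = (Real.exp (B * L) - 1) / (2 * B) + 1 / (2 * B) := by
    rw [← add_div]; ring_nf
  -- hence `1/y(t) ≥ 1/(2δ)`
  have hyt : (2 * δ)⁻¹ ≤ (y t)⁻¹ := by
    have h2 : (2 * δ)⁻¹ = δ⁻¹ / 2 := by ring
    rw [h2]
    linarith
  have hyle : y t ≤ 2 * δ := by
    have := inv_anti₀ (by positivity : (0 : ℝ) < (2 * δ)⁻¹) hyt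
    rwa [inv_inv, inv_inv] at this
  -- back to `D` and `W`
  have hDt : D t ≤ 2 * δ * Real.exp (B * L) := by
    have hDy : D t = Real.exp (B * t) * y t := by
      show D t = Real.exp (B * t) * (Real.exp (-(B * t)) * D t)
      rw [← mul_assoc, ← Real.exp_add]; simp
    rw [hDy]
    calc Real.exp (B * t) * y t ≤ Real.exp (B * L) * (2 * δ) :=
          mul_le_mul hexpL hyle (hypos t ht0).le (exp_pos _).le
      _ = 2 * δ * Real.exp (B * L) := by ring
  rw [hWSD t]
  have hSt : S t ≤ B := hB K t ht
  linarith

end IsNonnegCascade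

end SheetNSLineTorusCascade
end Summit.NavierStokesRegularity.OSWSelfSimilar
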